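import Summits.CriticalPhenomena.SAWScalingLimit.Theorems.SAWLoopFugacityFlowSimpleSubseqLimitsBoundaryPassage
import Summits.CriticalPhenomena.SAWScalingLimit.Theorems.SAWLoopFugacityFlowSimpleSubseqLimitsBoundaryCore
import Summits.CriticalPhenomena.SAWScalingLimit.Theorems.SAWLoopFugacityFlowSimpleSubseqLimitsFirstHitLine
import HarnessLib

/-!
# The A-SIDE-FREE lattice line of the crux `SimpleSubseqLimits` and its pins
(crux stmt-CriticalPhenomena-4982, decl `Summit.CriticalPhenomena.SAWScalingLimit.Theses.SAWLoopFugacityFlow.SimpleSubseqLimits`;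
line `past-shadowing-costs-halves`, reshaping v3; line lead c3, 2026-08-16)

§0 A NECESSITY PRINCIPLE FOR A.E. CLAUSES.  `exists_limsup_law_le_of_ae`: the landed principle
`Negative.exists_limsup_law_le_of_crux` (p84995) with the crux replaced by ANY clause `P D c` known to
hold `ν`-a.e. for every subsequential weak limit `ν` along `(D; a_δ, b_δ)` — under `EventualTight`, a
decreasing sequence of closed sets whose intersection misses `P D` is eventually `θ`-improbable in
`limsup_{δ → 0⁺}`. (Same proof: Prokhorov along offending meshes, closed-set portmanteau, continuity
from above.)

§1 THE LINE.  `line_lattice : FirstHitDecay → BoundaryDecay → SimpleSubseqLimits` — the crux from TWO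
PURE LATTICE statements about the critical `δℤ²` SAW law and NOTHING ELSE: simplicity of every
subsequential weak limit from the first-hit input (`FirstHit.Passage.ae_simple_of_firstHitDecayAt`,
Rohde–Schramm one level down, no SHAPE), the boundary clause from the boundary input
(`Boundary.Passage.ae_boundary_of_boundaryDecayAt`), endpoints and confinement free
(`Negative.simpleSubseqLimits_iff_core`). In particular the open A-side crux `AvoidanceLimit`
(stmt-10649) is NOT used — the three earlier lines all took the boundary clause from it.

§2 THE PINS OF THE BOUNDARY INPUT.  `boundaryDecay_of_sawScalingLimit` (summit-implied: not
over-strong), `boundaryDecay_of_crux : EventualTight → SimpleSubseqLimits → BoundaryDecay` (necessary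
given tightness), and `boundaryDecay_of_shape : EventualTight → AvoidanceValues → BoundaryDecay` (it is
WEAKER than what the earlier lines assumed: tightness + SHAPE give it), all from the principle applied to
`F n = closure (nearBoundaryVisitEvent D ρ (1/(n+1)))`, whose intersection consists of classes whose
trace TOUCHES `∂D` `ρ`-far from the marked points (`Boundary.Core.stub_boundaryCore`, p131357), hence
contains no class with the boundary clause.

§3 THE RESIDUAL CERTIFICATE.  `crux_iff_lattice : EventualTight → (SimpleSubseqLimits ↔
FirstHitDecay ∧ BoundaryDecay)` — modulo tightness ALONE (no A-side) the crux IS the conjunction of the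
two lattice inputs; `lattice_of_sawScalingLimit : SAWScalingLimit → FirstHitDecay ∧ BoundaryDecay`.
-/

noncomputable section

open MeasureTheory Filter Topology Set Metric Function
open Literature.Probability.RandomPlanarGeometry Literature.Probability.RandomPlanarGeometry.SAW
open Literature.Probability.LatticeModels
open scoped ENNReal NNReal BoundedContinuousFunction unitInterval

namespace Summit.CriticalPhenomena.SAWScalingLimit.Theorems.SimpleSubseqLimits.Boundary.Line

open Summit.CriticalPhenomena.SAWScalingLimit.Theses.SAWLoopFugacityFlow
  (SimpleSubseqLimits AvoidanceLimit AvoidancePassage SLEAvoidanceValue EventualTight)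
open Summit.CriticalPhenomena.SAWScalingLimit.Theorems.SimpleSubseqLimits.Negative
  (WeakLimitAlong Carrier simpleSubseqLimits_iff_core exists_limsup_law_le_of_sawScalingLimit
    limsup_law_closed_le_of_weakLimitAlong)
open Summit.CriticalPhenomena.SAWScalingLimit.Theorems.SubseqIdentification.Negative
  (exists_subseqConv_of_isTightAlongMesh isTightAlongMesh_of_eventualTight)
open Summit.CriticalPhenomena.SAWScalingLimit.Theorems.SimpleSubseqLimits.MarkedPointRevisit.Passage
  (IsSubseqLimit)
open Summit.CriticalPhenomena.SAWScalingLimit.Theorems.SimpleSubseqLimits.FirstHit.Passage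
  (FirstHitDecay ae_simple_of_firstHitDecayAt)
open Summit.CriticalPhenomena.SAWScalingLimit.Theorems.SimpleSubseqLimits.FirstHit.Line
  (firstHitDecay_of_sawScalingLimit firstHitDecay_of_crux)
open Summit.CriticalPhenomena.SAWScalingLimit.Theorems.SimpleSubseqLimits.PastShadowing.Main
  (AvoidanceValues rangeArc_of_avoidanceValues avoidanceValues_of_routeItems)
open Summit.CriticalPhenomena.SAWScalingLimit.Theorems.SimpleSubseqLimits.Boundary.Passage
  (NearBoundaryVisit nearBoundaryVisitEvent BoundaryDecayAt BoundaryDecay ae_boundary_of_boundaryDecayAt)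
open Summit.CriticalPhenomena.SAWScalingLimit.Theorems.SimpleSubseqLimits.Boundary.Core
  (stub_boundaryCore)

variable {D : DobrushinDomain} {a b : ℝ → Site 2}

/-! ## §0 The necessity principle for an arbitrary a.e. clause of subsequential limits -/

/-- **Necessity principle for a.e. clauses.** Let `P D c` be a property of curve classes which holds
`ν`-a.e. for EVERY subsequential weak limit `ν` of the critical SAW laws along `(D; a_δ, b_δ)`. Under
`EventualTight`, for every decreasing sequence of closed sets `F n ⊆ CurveClass ℂ` whose intersection
contains no class with `P D`, and every `θ > 0`, some `F n` has `limsup_{δ → 0⁺} P_δ[curve ∈ F n] ≤ θ`.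
Proof as for `Negative.exists_limsup_law_le_of_crux`: otherwise meshes `δₙ ∈ (0, 1/(n+1))` with
`θ < P_{δₙ}[F n]` carry a subsequential weak limit `ν` (Prokhorov under tightness) with `θ ≤ ν (F m)`
for every `m` (closed-set portmanteau, monotonicity), so `θ ≤ ν (⋂ F m)`; but `ν` lives on `P D`,
which misses `⋂ F m`. [folklore] -/
theorem exists_limsup_law_le_of_ae (hT : EventualTight) {P : DobrushinDomain → CurveClass ℂ → Prop}
    (hP : ∀ (s : ℕ → ℝ) (ν : Measure (CurveClass ℂ)), Tendsto s atTop (𝓝[>] (0 : ℝ)) →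
      IsProbabilityMeasure ν → WeakLimitAlong D a b s ν → ∀ᵐ c ∂ν, P D c)
    (hab : IsEndpointApprox D a b) {F : ℕ → Set (CurveClass ℂ)} (hF : ∀ n, IsClosed (F n))
    (hanti : Antitone F) (hcore : ∀ c : CurveClass ℂ, (∀ n, c ∈ F n) → ¬ P D c)
    {θ : ℝ≥0∞} (hθ : 0 < θ) :
    ∃ n, limsup (fun δ => law D.carrier δ (a δ) (b δ) {γ | γ.curve ∈ F n}) (𝓝[>] (0 : ℝ)) ≤ θ := by
  by_contra hcon
  push Not at hcon
  -- meshes `δₙ ∈ (0, 1/(n+1))` with `θ < P_{δₙ}[F n]`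
  have hex : ∀ n : ℕ, ∃ δ : ℝ, θ < law D.carrier δ (a δ) (b δ) {γ | γ.curve ∈ F n} ∧
      δ ∈ Ioo (0 : ℝ) (1 / ((n : ℝ) + 1)) := by
    intro n
    have hfr : ∃ᶠ δ in 𝓝[>] (0 : ℝ), θ < law D.carrier δ (a δ) (b δ) {γ | γ.curve ∈ F n} :=
      frequently_lt_of_lt_limsup (by isBoundedDefault) (hcon n)
    exact (hfr.and_eventually (Ioo_mem_nhdsGT (by positivity))).exists
  choose s hsθ hsI using hex
  have hs : Tendsto s atTop (𝓝[>] (0 : ℝ)) := by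
    refine tendsto_nhdsWithin_iff.2 ⟨?_, Eventually.of_forall fun n => (hsI n).1⟩
    exact squeeze_zero (fun n => (hsI n).1.le) (fun n => (hsI n).2.le)
      tendsto_one_div_add_atTop_nhds_zero_nat
  -- a subsequential weak limit along `s` (Prokhorov under `EventualTight`)
  have hT' : Summit.CriticalPhenomena.SAWScalingLimit.Theses.SAWRenewalTightness.EventualTight :=
    fun D a b h => hT D a b h
  obtain ⟨φ, ν, hφ, hν, hlim⟩ :=
    exists_subseqConv_of_isTightAlongMesh hab (isTightAlongMesh_of_eventualTight hT' hab) hs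
  -- the clause: `ν` lives on `P D`
  have hcar : ∀ᵐ c ∂ν, P D c := hP (s ∘ φ) ν (hs.comp hφ.tendsto_atTop) hν hlim
  have hw : WeakLimitAlong D a b (s ∘ φ) ν := hlim
  -- portmanteau along the subsequence: `θ ≤ ν (F m)` for every `m`
  have hθle : ∀ m, θ ≤ ν (F m) := by
    intro m
    refine le_trans ?_ (limsup_law_closed_le_of_weakLimitAlong hw (hF m))
    refine le_limsup_of_frequently_le' ?_
    refine ((eventually_ge_atTop m).mono fun k hk => ?_).frequently
    have hφk : m ≤ φ k := hk.trans (hφ.id_le k)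
    calc θ ≤ law D.carrier (s (φ k)) (a (s (φ k))) (b (s (φ k))) {γ | γ.curve ∈ F (φ k)} :=
          (hsθ (φ k)).le
      _ ≤ law D.carrier (s (φ k)) (a (s (φ k))) (b (s (φ k))) {γ | γ.curve ∈ F m} :=
          measure_mono fun γ hγ => hanti hφk hγ
  -- continuity from above: `θ ≤ ν (⋂ F m) = 0`
  have hlimF := tendsto_measure_iInter_atTop (μ := ν)
    (fun n : ℕ => (hF n).measurableSet.nullMeasurableSet) hanti ⟨0, measure_ne_top ν _⟩
  have hge : θ ≤ ν (⋂ n : ℕ, F n) := ge_of_tendsto' hlimF fun m => hθle m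
  have h0 : ν (⋂ n : ℕ, F n) = 0 := by
    rw [ae_iff] at hcar
    exact measure_mono_null (fun c hc hcar' => hcore c (mem_iInter.1 hc) hcar') hcar
  rw [h0] at hge
  exact lt_irrefl _ (hθ.trans_le hge)

/-! ## §1 The line: crux ⇐ first-hit decay ∧ boundary decay (no route item) -/

/-- **THE A-SIDE-FREE LATTICE LINE** for the crux `SimpleSubseqLimits` (all four routes wanting
stmt-CriticalPhenomena-4982): first-hit return decay (ORDER) and boundary decay (BOUNDARY) give the
crux — `ν`-a.s. simple by `FirstHit.Passage.ae_simple_of_firstHitDecayAt`, the boundary clause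
`range ∩ ∂D ⊆ {a, b}` by `Boundary.Passage.ae_boundary_of_boundaryDecayAt`, the rest free
(`Negative.simpleSubseqLimits_iff_core`). No route item — in particular not `AvoidanceLimit` — is used.
[folklore] -/
theorem line_lattice (hF : FirstHitDecay) (hB : BoundaryDecay) : SimpleSubseqLimits := by
  refine simpleSubseqLimits_iff_core.2 fun D a b hab s ν hs hν hw => ?_
  have hsimple := ae_simple_of_firstHitDecayAt hab (hF D a b hab) ⟨hs, hν, hw⟩
  have hbd := ae_boundary_of_boundaryDecayAt (hB D a b hab) (⟨hs, hν, hw⟩ : IsSubseqLimit D a b s ν)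
  filter_upwards [hsimple, hbd] with c h1 h2
  exact ⟨h1, h2⟩

/-! ## §2 The pins of the boundary input -/

/-- Near-boundary visits are monotone in the width `ε`. [folklore] -/
theorem nearBoundaryVisit_mono {γ : Curve ℂ} {ρ ε ε' : ℝ} (h : NearBoundaryVisit D γ ρ ε)
    (hε : ε ≤ ε') : NearBoundaryVisit D γ ρ ε' := by
  obtain ⟨t, ht, h0, h1⟩ := h
  exact ⟨t, ht.trans_le hε, h0, h1⟩

/-- The closed `1/(n+1)`-thickenings `n ↦ closure (nearBoundaryVisitEvent D ρ (1/(n+1)))` decrease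
in `n`. [folklore] -/
theorem antitone_thick (D : DobrushinDomain) (ρ : ℝ) :
    Antitone fun n : ℕ => closure (nearBoundaryVisitEvent D ρ (1 / ((n : ℝ) + 1))) := by
  intro m n hmn
  have hmn' : (m : ℝ) ≤ n := by exact_mod_cast hmn
  have hle : 1 / ((n : ℝ) + 1) ≤ 1 / ((m : ℝ) + 1) :=
    one_div_le_one_div_of_le (by positivity) (by linarith)
  refine closure_mono ?_
  rintro c ⟨γ, rfl, hγ⟩
  exact ⟨γ, rfl, nearBoundaryVisit_mono hγ hle⟩

/-- **Core.** For `ρ > 0`, a class lying in every closed thickening violates the boundary clause: by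
`Boundary.Core.stub_boundaryCore` its trace touches `∂D` at a point `ρ`-far from both marked points,
which is therefore neither of them. [folklore] -/
theorem thick_core {ρ : ℝ} (hρ : 0 < ρ) (c : CurveClass ℂ)
    (hc : ∀ n : ℕ, c ∈ closure (nearBoundaryVisitEvent D ρ (1 / ((n : ℝ) + 1)))) :
    ¬ (c.range ∩ frontier D.carrier ⊆ {D.pt 0, D.pt 1}) := by
  intro hsub
  obtain ⟨x, hx, hfr, h0, h1⟩ := stub_boundaryCore D ρ c hρ hc
  rcases hsub ⟨hx, hfr⟩ with h | h
  · rw [h, dist_self] at h0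
    exact absurd h0 (not_le.2 hρ)
  · rw [h, dist_self] at h1
    exact absurd h1 (not_le.2 hρ)

/-- **`BoundaryDecay` from any necessity principle for closed antitone thickenings with
boundary-clause-free core** (the common shape of the three instances below): at `(ρ, θ)` the principle
gives `n` with `limsup_δ P_δ[curve ∈ thick n] ≤ θ/2 < θ`, hence eventually
`P_δ[curve ∈ nearBoundaryVisitEvent D ρ (1/(n+1))] ≤ θ`; take `ε = 1/(n+1)`. [folklore] -/
theorem boundaryDecay_of_principle
    (Hp : ∀ (D : DobrushinDomain) (a b : ℝ → Site 2), IsEndpointApprox D a b →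
      ∀ {F : ℕ → Set (CurveClass ℂ)}, (∀ n, IsClosed (F n)) → Antitone F →
        (∀ c : CurveClass ℂ, (∀ n, c ∈ F n) → ¬ (c.range ∩ frontier D.carrier ⊆ {D.pt 0, D.pt 1})) →
          ∀ {θ : ℝ≥0∞}, 0 < θ →
            ∃ n, limsup (fun δ => law D.carrier δ (a δ) (b δ) {γ | γ.curve ∈ F n}) (𝓝[>] (0 : ℝ)) ≤ θ) :
    BoundaryDecay := by
  intro D a b hab ρ θ hρ hθ
  have hθ' : (0 : ℝ≥0∞) < ENNReal.ofReal θ / 2 :=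
    ENNReal.half_pos (ENNReal.ofReal_pos.2 hθ).ne'
  obtain ⟨n, hn⟩ := Hp D a b hab
    (F := fun n : ℕ => closure (nearBoundaryVisitEvent D ρ (1 / ((n : ℝ) + 1))))
    (fun _ => isClosed_closure) (antitone_thick D ρ) (thick_core hρ) hθ'
  refine ⟨1 / ((n : ℝ) + 1), by positivity, ?_⟩
  have hle : limsup (fun δ => law D.carrier δ (a δ) (b δ)
      {γ | γ.curve ∈ nearBoundaryVisitEvent D ρ (1 / ((n : ℝ) + 1))}) (𝓝[>] (0 : ℝ)) ≤
        ENNReal.ofReal θ / 2 := by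
    refine le_trans (Filter.limsup_le_limsup (Eventually.of_forall fun δ => ?_)) hn
    exact measure_mono fun γ hγ => subset_closure hγ
  have hlt : limsup (fun δ => law D.carrier δ (a δ) (b δ)
      {γ | γ.curve ∈ nearBoundaryVisitEvent D ρ (1 / ((n : ℝ) + 1))}) (𝓝[>] (0 : ℝ)) <
        ENNReal.ofReal θ :=
    hle.trans_lt (ENNReal.half_lt_self (ENNReal.ofReal_pos.2 hθ).ne' ENNReal.ofReal_ne_top)
  filter_upwards [Filter.eventually_lt_of_limsup_lt hlt] with δ hδ using hδ.le

/-- **`BoundaryDecay` is implied by the summit conjecture** `SAWScalingLimit` (the boundary input is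
not over-strong in truth value): the SLE_(8/3) law lives on the carrier, whose classes satisfy the
boundary clause. [folklore] -/
theorem boundaryDecay_of_sawScalingLimit (h : _root_.SAWScalingLimit) : BoundaryDecay :=
  boundaryDecay_of_principle fun _ _ _ hab _ hF hanti hcore _ hθ =>
    exists_limsup_law_le_of_sawScalingLimit h hab hF hanti
      (fun c hc hcar => hcore c hc hcar.2.2.2.2) hθ

/-- **`BoundaryDecay` is NECESSARY for the crux given `EventualTight`** (no proof of the crux under
tightness avoids proving it). [folklore] -/
theorem boundaryDecay_of_crux (hT : EventualTight) (hS : SimpleSubseqLimits) : BoundaryDecay :=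
  boundaryDecay_of_principle fun D a b hab _ hF hanti hcore _ hθ =>
    exists_limsup_law_le_of_ae hT (P := Carrier)
      (fun s ν hs hν hw => hS D a b hab s ν hs hν hw) hab hF hanti
      (fun c hc hcar => hcore c hc hcar.2.2.2.2) hθ

/-- **`BoundaryDecay` is WEAKER than tightness + SHAPE**: under `EventualTight`, the hull-avoidance
values of subsequential limits (`PastShadowing.Main.AvoidanceValues`, the SHAPE input of the earlier
lines) already give it — SHAPE puts every subsequential limit on classes with the boundary clause
(`rangeArc_of_avoidanceValues`), and the principle for that clause applies. [folklore] -/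
theorem boundaryDecay_of_shape (hT : EventualTight) (hAV : AvoidanceValues) : BoundaryDecay :=
  boundaryDecay_of_principle fun D a b hab _ hF hanti hcore _ hθ =>
    exists_limsup_law_le_of_ae hT
      (P := fun D c => c.range ∩ frontier D.carrier ⊆ {D.pt 0, D.pt 1})
      (fun s ν hs hν hw => (rangeArc_of_avoidanceValues hAV D a b hab s ν hs hν hw).mono
        fun _ hc => hc.2) hab hF hanti hcore hθ

/-- Hence the three A-side route items of SAWLoopFugacityFlow / SAWSteinDefect give `BoundaryDecay`
under `EventualTight`: the earlier first-hit line (`FirstHit.Line.line_firstHit`) factors through the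
lattice line modulo tightness. [folklore] -/
theorem boundaryDecay_of_routeItems (hT : EventualTight) (hA : AvoidanceLimit) (hP : AvoidancePassage)
    (hV : SLEAvoidanceValue) : BoundaryDecay :=
  boundaryDecay_of_shape hT (avoidanceValues_of_routeItems hA hP hV)

/-! ## §3 The residual certificate: crux ⟺ the two lattice inputs, modulo tightness alone -/

/-- **RESIDUAL CERTIFICATE.** Under `EventualTight` (stmt-1372, wanted by every SAW route) the crux IS
the conjunction of its two lattice inputs: `SimpleSubseqLimits ↔ FirstHitDecay ∧ BoundaryDecay`. No
A-side item enters (compare `FirstHit.Line.crux_iff_firstHitDecay` and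
`PastShadowing.Main.crux_iff_shadowDecay`, both modulo tightness AND the A-side). [folklore] -/
theorem crux_iff_lattice (hT : EventualTight) : SimpleSubseqLimits ↔ FirstHitDecay ∧ BoundaryDecay :=
  ⟨fun hS => ⟨firstHitDecay_of_crux hT hS, boundaryDecay_of_crux hT hS⟩,
    fun h => line_lattice h.1 h.2⟩

/-- **Both lattice inputs are implied by the summit conjecture** (neither is over-strong). [folklore] -/
theorem lattice_of_sawScalingLimit (h : _root_.SAWScalingLimit) : FirstHitDecay ∧ BoundaryDecay :=
  ⟨firstHitDecay_of_sawScalingLimit h, boundaryDecay_of_sawScalingLimit h⟩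

/-- Route-neutral reading for the planner: the crux from the conjunction of the two lattice inputs,
stated as ONE hypothesis (the form to promote as a single item). [folklore] -/
theorem simpleSubseqLimits_of_latticeInputs (h : FirstHitDecay ∧ BoundaryDecay) : SimpleSubseqLimits :=
  line_lattice h.1 h.2

/-! ## §4 The promotable item, self-contained (events inlined, Literature vocabulary only) -/

/-- **The two lattice inputs as ONE self-contained statement** (`FirstHitDecay ∧ BoundaryDecay` with
the vocabulary of `FirstHit.Passage` / `Boundary.Passage` INLINED, so that it elaborates in a route file,
which cannot import these Theorems modules without an import cycle): (i) first-hit return decay — for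
every closed ball `B̄(q, r)`, separation `ρ` and target `θ` there are a width `ε` and an outer radius
`r' > r` such that, eventually as `δ → 0⁺`, with probability `≤ θ` some representative of the walk's
curve class has times `v < T ≤ t'` with the curve `r`-far from `q` on `[0, v]`, `r'`-close to `q` at
`T`, `γ v` `ρ`-far from `γ T`, and `γ t'` `ε`-close to `γ v`; (ii) boundary decay — for every `ρ, θ`
there is `ε` such that, eventually, with probability `≤ θ` some representative visits the open
`ε`-neighbourhood of `∂D` at a point `ρ`-far from both marked points. An open statement of this crux
(the form recommended for promotion) — deliberately untagged: it is not a literature fact. -/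
def LatticeInputs : Prop :=
  (∀ (D : DobrushinDomain) (a b : ℝ → Site 2), SAW.IsEndpointApprox D a b →
    ∀ (q : ℂ) (r ρ θ : ℝ), 0 < r → 0 < ρ → 0 < θ → ∃ ε r' : ℝ, 0 < ε ∧ r < r' ∧
      ∀ᶠ δ in 𝓝[>] (0 : ℝ),
        SAW.law D.carrier δ (a δ) (b δ) {γ | ∃ γ' : Curve ℂ, CurveClass.mk γ' = γ.curve ∧
          ∃ v T t' : I, v < T ∧ T ≤ t' ∧ (∀ u : I, u ≤ v → r < dist (γ' u) q) ∧
            dist (γ' T) q < r' ∧ ρ < dist (γ' v) (γ' T) ∧ dist (γ' t') (γ' v) < ε} ≤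
          ENNReal.ofReal θ) ∧
  (∀ (D : DobrushinDomain) (a b : ℝ → Site 2), SAW.IsEndpointApprox D a b →
    ∀ ρ θ : ℝ, 0 < ρ → 0 < θ → ∃ ε : ℝ, 0 < ε ∧
      ∀ᶠ δ in 𝓝[>] (0 : ℝ),
        SAW.law D.carrier δ (a δ) (b δ) {γ | ∃ γ' : Curve ℂ, CurveClass.mk γ' = γ.curve ∧
          ∃ t : I, infDist (γ' t) (frontier D.carrier) < ε ∧ ρ < dist (γ' t) (D.pt 0) ∧
            ρ < dist (γ' t) (D.pt 1)} ≤ ENNReal.ofReal θ)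

/-- The self-contained statement IS the conjunction of the two lattice inputs (definitional).
[folklore] -/
theorem latticeInputs_iff : LatticeInputs ↔ FirstHitDecay ∧ BoundaryDecay := Iff.rfl

/-- **Glue for the promoted item**: the self-contained lattice statement proves the crux. [folklore] -/
theorem simpleSubseqLimits_of_latticeInputs' (h : LatticeInputs) : SimpleSubseqLimits :=
  simpleSubseqLimits_of_latticeInputs (latticeInputs_iff.1 h)

/-- … and is equivalent to it modulo `EventualTight`, and implied by the summit conjecture. [folklore] -/
theorem crux_iff_latticeInputs (hT : EventualTight) : SimpleSubseqLimits ↔ LatticeInputs :=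
  (crux_iff_lattice hT).trans latticeInputs_iff.symm

/-- The self-contained lattice statement is implied by the summit conjecture. [folklore] -/
theorem latticeInputs_of_sawScalingLimit (h : _root_.SAWScalingLimit) : LatticeInputs :=
  latticeInputs_iff.2 (lattice_of_sawScalingLimit h)

/-- **Registered form (stub `stub_latticeLine` of the crux item stmt-CriticalPhenomena-4982).** The
A-side-free lattice line: the crux from its two lattice inputs. [folklore] -/
theorem stub_latticeLine : FirstHitDecay → BoundaryDecay → SimpleSubseqLimits :=
  line_lattice

end Summit.CriticalPhenomena.SAWScalingLimit.Theorems.SimpleSubseqLimits.Boundary.Line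

end
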